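import Summits.NavierStokesRegularity.NavierStokesRegularity.Theorems.TerminalTraceTypeITraceScarL3ExtinctApexPressureUnit
import Summits.NavierStokesRegularity.NavierStokesRegularity.Theorems.TerminalTraceTypeITraceScarL3StubExtinctApexOfL3Trace
import Literature.Analysis.FluidPDE.NSViscosityRescaling
import Literature.Analysis.FluidPDE.NSLerayHopfABCScaling
import HarnessLib

/-!
# Line `apex-dichotomy` of `TerminalTrace.TypeITraceScarL3` (stmt-NavierStokesRegularity-18385) —
# STUB 2′ `stub_extinctApexD_of_L3trace`, BY NAME AND SIGNATURE

Route `TerminalTrace` (NavierStokesRegularity), item `TypeITraceScarL3`, registered skeleton `apex-dichotomy`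
(nsreg-p2 g27, ROUND-25, sha16 95aa062ef93d7802; Stub 1 `stub_localTypeI_of_typeIBlowup` ✓ p576636; Stub 2′ here;
Stub B `stub_no_confinedExtinctApex`; Stub C `stub_no_spreadExtinctApex` = the open hard core).  Seat ns-typeII-p3 g9
(cell ns-regularity-ideate; planner's RULING 23:01Z «p3 takes 2′»), `--supports stmt-NavierStokesRegularity-18385`.

* **`stub_extinctApexD_of_L3trace`** — the registered signature verbatim: in the frame of the item (`ν, T > 0`,
  classical on `[0, T)`, Leray–Hopf on `[0, T]`, Type-I in time), at a backward-singular apex `(T, x₀)` with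
  `u(T) ∈ L³(B(x₀, ρ))` there is an EXTINCT TYPE-I APEX `(U, P, G, M, D₀, C)`: suitable in every `Q(a)` with weak
  gradient `G`, `𝐈(Q(a)) ≤ M`, PLAIN `cknD r z₀ P ≤ D₀` at every apex `z₀.1 ≤ 0` and radius `r > 0`, rate
  `C/√(−s)`, weakly vanishing at the top time, backward-singular at the origin.  Proof: the viscosity
  normalisation `v(s, x) = ν⁻¹ u(s/ν, x)` of `…StubExtinctApexOfL3Trace` (`IsClassicalNSSolutionOn.viscosityRescale_set`,
  `IsLerayHopfOn.viscosityRescale`, the rate inline, `not_isBackwardBoundedAt_viscosityRescale`,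
  `not_isBackwardBoundedAt_of_forall_eLpNorm_top`) and `extinctApexD_of_L3trace_unit`; the local Albritton–Barker
  bound among the hypotheses is not needed (the global Type-I rate gives the Morrey bound).

WHAT THIS IS NOT: not NS regularity, not item 18385, not Stub B/C.  [folklore; AlbrittonBarker2019 §3; SereginSverak2009
(as13); WangZhang2016 §4; Seregin2014 §6.6; Tao 2013 footnote 3]
-/

noncomputable section

set_option linter.dupNamespace false

namespace Summit.NavierStokesRegularity.NavierStokesRegularity.Theorems.TypeITraceScarL3

open MeasureTheory Set Function Filter Topology TopologicalSpace Metric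
open Literature.Analysis.FluidPDE
open scoped NNReal ENNReal InnerProductSpace RealInnerProductSpace

/-- **STUB 2′ of line `apex-dichotomy` (item stmt-NavierStokesRegularity-18385 `TerminalTrace.TypeITraceScarL3`),
registered signature.**  A backward-singular apex point of a Type-I-in-time first singularity whose terminal value
is `L³` near `x₀` yields, after ν-normalisation and a parabolic zoom along a subsequence, an EXTINCT TYPE-I APEX
with uniformly `D`-bounded pressure at every apex (module docstring).
[folklore; AlbrittonBarker2019 §3 Rem. 3.2, Lemma 2.2, Prop. 2.3; SereginSverak2009 (as13); WangZhang2016 §4 (4.3)–(4.4); Seregin2014 §6.6 Prop. 6.20] -/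
theorem stub_extinctApexD_of_L3trace :
    ∀ (ν T : ℝ), 0 < ν → 0 < T →
      ∀ (u : ℝ → EuclideanSpace ℝ (Fin 3) → EuclideanSpace ℝ (Fin 3))
        (p : ℝ → EuclideanSpace ℝ (Fin 3) → ℝ),
      IsClassicalNSSolutionOn (Ico 0 T) ν 0 u p → IsLerayHopfOn T ν 0 (u 0) u →
      IsTypeIBlowup u T → ∀ x₀ : EuclideanSpace ℝ (Fin 3),
      (∃ r₀ : ℝ, 0 < r₀ ∧
        ∃ G : ℝ → EuclideanSpace ℝ (Fin 3) →
          EuclideanSpace ℝ (Fin 3) →L[ℝ] EuclideanSpace ℝ (Fin 3),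
          HasWeakSpatialGradientOn (parabolicCylinderOpens r₀ (T, x₀)) u G ∧
          typeIBound (parabolicCylinder r₀ (T, x₀)) u p G < ∞) →
      (∀ r : ℝ, 0 < r →
        eLpNorm (uncurry u) ⊤ (volume.restrict (parabolicCylinder r (T, x₀))) = ⊤) →
      (∃ ρ : ℝ, 0 < ρ ∧ MemLp (u T) 3 (volume.restrict (ball x₀ ρ))) →
        ∃ (U : ℝ → EuclideanSpace ℝ (Fin 3) → EuclideanSpace ℝ (Fin 3))
          (P : ℝ → EuclideanSpace ℝ (Fin 3) → ℝ)
          (G : ℝ → EuclideanSpace ℝ (Fin 3) →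
            EuclideanSpace ℝ (Fin 3) →L[ℝ] EuclideanSpace ℝ (Fin 3))
          (M D₀ : ℝ≥0) (C : ℝ),
          (∀ a : ℝ, 0 < a →
            IsSuitableWeakSolutionInBall a (0 : ℝ × EuclideanSpace ℝ (Fin 3)) U P) ∧
          (∀ a : ℝ, 0 < a →
            HasWeakSpatialGradientOn
              (parabolicCylinderOpens a (0 : ℝ × EuclideanSpace ℝ (Fin 3))) U G) ∧
          (∀ a : ℝ, 0 < a →
            typeIBound (parabolicCylinder a (0 : ℝ × EuclideanSpace ℝ (Fin 3))) U P G ≤ M) ∧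
          (∀ z₀ : ℝ × EuclideanSpace ℝ (Fin 3), z₀.1 ≤ 0 →
            ∀ r : ℝ, 0 < r → cknD r z₀ P ≤ D₀) ∧
          (∀ s : ℝ, s < 0 →
            ∀ᵐ y : EuclideanSpace ℝ (Fin 3), ‖U s y‖ ≤ C / Real.sqrt (-s)) ∧
          (∀ φ : EuclideanSpace ℝ (Fin 3) → EuclideanSpace ℝ (Fin 3),
            ContDiff ℝ (⊤ : ℕ∞) φ →
            HasCompactSupport φ → ∀ ε : ℝ, 0 < ε →
            ∃ s₀ : ℝ, s₀ < 0 ∧ ∀ᵐ s ∂(volume.restrict (Ioo s₀ 0)), |∫ y, ⟪U s y, φ y⟫| ≤ ε) ∧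
          IsBackwardSingularPoint U (0 : ℝ × EuclideanSpace ℝ (Fin 3)) := by
  intro ν T hν hT u p hcl hLH hI x₀ _ hsing htr
  obtain ⟨ρ, hρ, hmem⟩ := htr
  have hν0 : ν ≠ 0 := hν.ne'
  have hνi : 0 < ν⁻¹ := inv_pos.2 hν
  have hνT : 0 < ν * T := mul_pos hν hT
  -- the apex is not backward bounded
  have hnotbd : ¬ IsBackwardBoundedAt u T x₀ := not_isBackwardBoundedAt_of_forall_eLpNorm_top hsing
  -- ## viscosity normalisation `v(s, x) = ν⁻¹ u(s/ν, x)`, blow-up time `νT`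
  set v : ℝ → EuclideanSpace ℝ (Fin 3) → EuclideanSpace ℝ (Fin 3) := timeRescale ν⁻¹ ν⁻¹ u with hv
  set pv : ℝ → EuclideanSpace ℝ (Fin 3) → ℝ := timeRescale ν⁻¹ (ν⁻¹ ^ 2) p with hpv
  have hmaps : MapsTo (fun s => ν⁻¹ * s) (Ico 0 (ν * T)) (Ico 0 T) := by
    intro s hs
    refine ⟨mul_nonneg hνi.le hs.1, ?_⟩
    calc ν⁻¹ * s < ν⁻¹ * (ν * T) := mul_lt_mul_of_pos_left hs.2 hνi
      _ = T := by rw [← mul_assoc, inv_mul_cancel₀ hν0, one_mul]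
  -- (1) classical at viscosity 1 on `[0, νT)`
  have hclv : IsClassicalNSSolutionOn (Ico 0 (ν * T)) 1 0 v pv := by
    have h := hcl.viscosityRescale_set hν0 hmaps (uniqueDiffOn_Ico 0 (ν * T))
    rwa [timeRescale_zero_force] at h
  -- (2) Leray–Hopf on `[0, νT]`
  have hv0 : ν⁻¹ • u 0 = v 0 := by
    funext x
    simp [hv]
  have hLHv : IsLerayHopfOn (ν * T) 1 0 (v 0) v := by
    have h := hLH.viscosityRescale hνi
    have e1 : T / ν⁻¹ = ν * T := by rw [div_inv_eq_mul, mul_comm]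
    rwa [e1, inv_mul_cancel₀ hν0, timeRescale_zero_force, hv0] at h
  -- (3) the Type-I rate and (4) the apex
  have hIv : IsTypeIBlowup v (ν * T) := by
    -- the Type-I rate in time passes to the rescaling (inlined; the tree's
    -- `isTypeIBlowup_timeRescale` lives in a module with a route-file import cone)
    obtain ⟨C, hC⟩ := hI
    have e0 : ν⁻¹ * (ν * T) = T := by rw [← mul_assoc, inv_mul_cancel₀ hν0, one_mul]
    have htend : Tendsto (fun s : ℝ => ν⁻¹ * s) (𝓝[<] (ν * T)) (𝓝[<] T) := by
      refine tendsto_nhdsWithin_of_tendsto_nhds_of_eventually_within _ ?_ ?_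
      · have h := ((continuous_const_mul ν⁻¹).tendsto (ν * T)).mono_left
          (nhdsWithin_le_nhds (s := Iio (ν * T)))
        rwa [e0] at h
      · refine eventually_nhdsWithin_of_forall fun s hs => ?_
        have h := mul_lt_mul_of_pos_left (mem_Iio.1 hs) hνi
        rwa [e0] at h
    refine ⟨C / Real.sqrt ν, ?_⟩
    filter_upwards [htend.eventually hC, self_mem_nhdsWithin] with s hs hsT x
    have hsT' : s < ν * T := hsT
    have hpos : 0 < ν * T - s := sub_pos.2 hsT'
    have e : T - ν⁻¹ * s = ν⁻¹ * (ν * T - s) := by field_simp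
    have hsq : Real.sqrt (T - ν⁻¹ * s) = (Real.sqrt ν)⁻¹ * Real.sqrt (ν * T - s) := by
      rw [e, Real.sqrt_mul hνi.le, Real.sqrt_inv]
    have hb := hs x
    rw [hsq] at hb
    have hsν : 0 < Real.sqrt ν := Real.sqrt_pos.2 hν
    have hsνsq : Real.sqrt ν * Real.sqrt ν = ν := Real.mul_self_sqrt hν.le
    have hsqpos : 0 < Real.sqrt (ν * T - s) := Real.sqrt_pos.2 hpos
    rw [le_div_iff₀ (by positivity)] at hb
    have hνinv : ν⁻¹ = (Real.sqrt ν)⁻¹ * (Real.sqrt ν)⁻¹ := by rw [← mul_inv, hsνsq]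
    have key : ν⁻¹ * ‖u (ν⁻¹ * s) x‖ ≤ C / Real.sqrt ν / Real.sqrt (ν * T - s) := by
      rw [le_div_iff₀ hsqpos]
      calc ν⁻¹ * ‖u (ν⁻¹ * s) x‖ * Real.sqrt (ν * T - s)
          = (Real.sqrt ν)⁻¹ * (‖u (ν⁻¹ * s) x‖ * ((Real.sqrt ν)⁻¹ * Real.sqrt (ν * T - s))) := by
              rw [hνinv]; ring
        _ ≤ (Real.sqrt ν)⁻¹ * C := mul_le_mul_of_nonneg_left hb (inv_nonneg.2 hsν.le)
        _ = C / Real.sqrt ν := by rw [div_eq_inv_mul]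
    have e2 : ‖v s x‖ = ν⁻¹ * ‖u (ν⁻¹ * s) x‖ := by
      rw [hv, timeRescale_apply, norm_smul, Real.norm_eq_abs, abs_of_pos hνi]
    exact e2 ▸ key
  have hnotbdv : ¬ IsBackwardBoundedAt v (ν * T) x₀ := not_isBackwardBoundedAt_viscosityRescale hν hnotbd
  -- (5) the `L³` ball of the final value: `v(νT) = ν⁻¹ u(T)`
  have hmemv : MemLp (v (ν * T)) 3 (volume.restrict (ball x₀ ρ)) := by
    have e : v (ν * T) = fun x => ν⁻¹ • u T x := by
      funext x
      rw [hv, timeRescale_apply, ← mul_assoc, inv_mul_cancel₀ hν0, one_mul]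
    rw [e]
    exact hmem.const_smul ν⁻¹
  -- ## the unit-viscosity theorem
  exact extinctApexD_of_L3trace_unit hνT hclv hLHv hIv x₀ hnotbdv hρ hmemv

end Summit.NavierStokesRegularity.NavierStokesRegularity.Theorems.TypeITraceScarL3

end
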